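import Mathlib
import Summits.Ventures.PercRepro2.CoinChainScQprime
import Summits.Ventures.PercRepro2.CoinChainPivotalMean

/-!
# Row 2′DARC at the pure AND-switch chain — UNCONDITIONAL (blind cell PercRepro2, night-2 g24;
proofs/NIGHT2-DARC.md §64)

`darc_of_pureChain_universal`: row 2′DARC at an OR-tail with the free arc `a → w`, point markers
`m₁, m₂ ∈ U`, sure entries `ent'` into `a'`, `a` entered from `a'` alone by the chain coin,
a log-supermodular core, positive world masses and a positive ideal mass — for EVERY probability
vector, with NO further hypothesis: the six-case hypothesis `hcase` of
`darc_of_pureChain_of_sixCases` is discharged by (Q′) (`pureChain_Qprime`), which rests on the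
gate-only inequality (SC) (`sc_functional_nonneg`).  The composition is exactly that of
`darc_of_pureChain_of_pivotalX`: `chain_darc_of_functional` with `chainPhi_head_hyps` and
`OrTailU.head_props`, the chain data `ν = P(level)`, `c = chainC`, `d = chainD`, `d' = chainD'`.
-/

namespace Summit.Ventures.PercRepro2.Coin

open Classical

section ScDarc

variable {V : Type*} {E : Type*} [Fintype V] [DecidableEq V] [Fintype E] [DecidableEq E]
  {R : Type*} [Field R] [LinearOrder R] [IsStrictOrderedRing R]
  {arcs : E → Finset (V × V)} {s : V} {U : Finset V} {ent' : Finset V} {c' : V → E}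
  {a' a w : V} {c : V → E}

/-- **ROW 2′DARC AT THE PURE AND-SWITCH CHAIN, UNCONDITIONALLY** (chain data `ν = P(level)`,
`c = chainC`, `d = chainD`, `d' = chainD'`, point markers `m₁, m₂`, an lsm core, positive world
masses and ideal mass): `DARC pr arcs s {t} m₁ m₂ a w`. -/
theorem darc_of_pureChain_universal (pr : E → R) (hp : IsProbVec pr) (hS : SameEnds arcs)
    (h' : OrTailK arcs s U ent' c' a') (hsure' : ∀ r ∈ ent', pr (c' r) = 1)
    (h : OrTailK arcs s (insert a' U) (insert a' ∅) c a)
    {m₁ m₂ : V} (hm₁ : m₁ ∈ U) (hm₂ : m₂ ∈ U)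
    (hν : ∀ W W', W ⊆ U → W' ⊆ U →
      prob pr (coreLevel arcs s U W) * prob pr (coreLevel arcs s U W') ≤
        prob pr (coreLevel arcs s U (W ∩ W')) * prob pr (coreLevel arcs s U (W ∪ W')))
    {t : V} (htC : t ∉ insert a (insert a' U)) (hts : t ≠ s) (hws : w ≠ s)
    (hwC : w ∉ insert a (insert a' U))
    (hpos0 : 0 < ∑ W ∈ U.powerset, prob pr (coreLevel arcs s U W) * chainC pr arcs s t U ent' a' a W)
    (hpos1 : 0 < ∑ W ∈ U.powerset, prob pr (coreLevel arcs s U W) *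
      chainMix ∅ ent' 1 (chainC pr arcs s t U ent' a' a) (chainD pr arcs s t U ent' a' a) W)
    (hmI : 0 < ∑ W ∈ U.powerset.filter (fun W => ¬ ∃ r ∈ ent', r ∈ W),
      prob pr (coreLevel arcs s U W) * chainC pr arcs s t U ent' a' a W) :
    DARC pr arcs s {t} m₁ m₂ a w := by
  obtain ⟨hA0, hAmono, hAlsm⟩ := OrTailU.head_props (U := insert a' U) (a := a) pr hp hS t
  obtain ⟨hdc, hd'd, hcc, hdd, hd'd', hdd', hratio, hratio', -, hcd, hcd'⟩ :=
    chainPhi_head_hyps (fun X => prob pr (coreAvoidEvent arcs s t (insert a (insert a' U)) X))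
      ent' a' a w hA0 hAmono hAlsm
  have hx0 : ∀ W : Finset V, (0 : R) ≤ (if m₁ ∈ W then (1 : R) else 0) := by
    intro W; split_ifs <;> norm_num
  have hy0 : ∀ W : Finset V, (0 : R) ≤ (if m₂ ∈ W then (1 : R) else 0) := by
    intro W; split_ifs <;> norm_num
  have hxm : ∀ s t : Finset V,
      (if m₁ ∈ s then (1 : R) else 0) ≤ (if m₁ ∈ s ∪ t then (1 : R) else 0) := by
    intro s t
    by_cases h : m₁ ∈ s
    · rw [if_pos h, if_pos (Finset.mem_union_left t h)]
    · rw [if_neg h]; split_ifs <;> norm_num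
  have hym : ∀ s t : Finset V,
      (if m₂ ∈ s then (1 : R) else 0) ≤ (if m₂ ∈ s ∪ t then (1 : R) else 0) := by
    intro s t
    by_cases h : m₂ ∈ s
    · rw [if_pos h, if_pos (Finset.mem_union_left t h)]
    · rw [if_neg h]; split_ifs <;> norm_num
  refine chain_darc_of_functional pr hS h' hsure' h (by simp) (Finset.empty_subset _) hm₁ hm₂ htC hts hws hwC ?_
  exact pureChain_functional_nonneg_universal U ent' (fun W => prob pr (coreLevel arcs s U W))
    (chainC pr arcs s t U ent' a' a) (chainD pr arcs s t U ent' a' a) (chainD' pr arcs s t U ent' a' a w)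
    (pr (c a')) (hp.nonneg _) (hp.le_one _) (fun W => prob_nonneg hp _)
    (fun s' hs' t' ht' => hν s' t' hs' ht') (fun W => hA0 _) (fun W => hA0 _) (fun W => hA0 _)
    hdc (fun W => le_trans (hd'd W) (hdc W)) hd'd hcc hdd hd'd' hcd hcd' hdd' hratio hratio'
    (fun W => if m₁ ∈ W then (1 : R) else 0) (fun W => if m₂ ∈ W then (1 : R) else 0)
    hx0 hy0 hxm hym hpos0 hpos1 hmI

end ScDarc

end Summit.Ventures.PercRepro2.Coin
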